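import Summits.BirchSwinnertonDyer.BirchSwinnertonDyer.Theorems.ManinLocalTwoThreePrimeShiftDescentEngine
import Summits.BirchSwinnertonDyer.BirchSwinnertonDyer.Theorems.ManinLocalTwoThreePrimeShiftFermatQuotient
import Summits.BirchSwinnertonDyer.Rank1Residual.ManinAdditive.PrimeShiftEqualiserLawEdges
import HarnessLib

/-!
# The PRIME-GENERIC `p`-power tower: `K_p(p^k N₀) = D` for ALL `k ≥ 1` from TWO single-depth laws per prime —
# the steps above depth `p³` are AUTOMATIC, the step `p²N₀ → pN₀` is ABSORBED by the Fermat-quotient character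
# (route `ManinLocalTwoThree`, cell bsd-f2-manin; the LEAD's law `ShiftEqualiser.PrimeShiftInvariantIsDiamond`, T-p1-g11-2;
# prover seat p3 gen 11)

With the engine `PrimeShift.descent` (`…PrimeShiftDescentEngine.lean`): an additive `p`-shift-invariant `φ : Γ₀(p²n) → K`
descends to `Γ₀(pn)` as soon as `φ(P_{2/p}) = φ(P_{1/p})`.  This file supplies that vanishing / absorbs its failure:
* §1 (`(p : K) = 0`, **`p² ∣ n`**): both parabolics shift ONCE (their upper-right entries `n`, `4n` are divisible by `p`) to
  `p`-th powers of parabolics of `Γ₀(p²n)` (`unipotent_pow`), so `φ(P_{1/p}) = φ(P_{2/p}) = 0` and the descent is AUTOMATIC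
  (`descent_of_sq_dvd`, `step_of_sq_dvd`) — the prime-generic form of the seat's `16 ∣ 4m` step at `p = 2` and of THEOREM III
  above depth `27` at `p = 3`;
* §2 (`K` a field of characteristic `p`, **`n = N₀` prime to `p`**): the Fermat-quotient character `ψ = q_p ∘ d`
  (`…PrimeShiftFermatQuotient.lean`: additive and diamond on `Γ₀(L)` for `p² ∣ L`) has `ψ(P_{2/p}) − ψ(P_{1/p}) = −N₀ ≠ 0`, so
  `φ − κ·ψ` descends for the right `κ` (`step_absorb`) — the prime-generic form of the seat's `χ₄`-step;
* §3 the TOWER **`shiftInvariantIsDiamondAt_tower`**: from `K_p(pN₀) = D` (the index-`(p+1)` step, p2's Serre base + transfer —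
  NOT proved here for `p ≥ 5`) and the ONE step `K_p(p²N₀) = D → K_p(p³N₀) = D` (where no congruence character certifies the
  vanishing — es's §37.13 (C) phenomenon; at `p = 3` it took the Heisenberg pair, whose `p ≥ 5` input is p2's
  `exists_heisenbergLift_of_five_le`) follow `K_p(p^k N₀) = D` for every `k ≥ 1`; BY NAME
  **`primeShiftInvariantIsDiamondAtPrime_of_bases`** and **`primeShiftInvariantIsDiamond_of_bases`**: the LEAD's law
  `PrimeShiftInvariantIsDiamond` ⟸ for each prime `p ≥ 5` the two single-depth laws `Base₁(p)`, `Step₃(p)` (its `p = 2, 3`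
  instances and `p ∤ N` are tree theorems, `ShiftEqualiser.primeShiftInvariantIsDiamond_iff_five_le_dvd`).
HONEST FRAMING: a REDUCTION; the LEAD's law stays OPEN at `p ≥ 5` (exactly `Base₁(p)` and `Step₃(p)` remain); nothing about BSD,
Manin's conjecture or C2/C3 is proved here.  Census support for the law: HOME/p1/CENSUS-shift-equaliser-p1-g11.md (55/55).
Reference: cell memo HOME/MEMO-es.md §37.8, §37.13 [cite: DarmonDiamondTaylor1995, Lemma 4.28 (p. 135)].
-/

set_option autoImplicit false
set_option linter.dupNamespace false

open scoped MatrixGroups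

open CongruenceSubgroup Matrix.SpecialLinearGroup
open Summit.BirchSwinnertonDyer.Rank1Residual.ManinAdditive.NineShiftEqualiser (slOf g0Of g0Of_congr)
open Summit.BirchSwinnertonDyer.Rank1Residual.ManinAdditive.ShiftEqualiser (IsAdd IsShiftInvariant IsDiamond RestrictsFrom
  ShiftInvariantIsDiamondAt PrimeShiftInvariantIsDiamond PrimeShiftInvariantIsDiamondAtPrime
  primeShiftInvariantIsDiamondAtPrime_of_dvd primeShiftInvariantIsDiamond_iff_five_le_dvd)
open Summit.BirchSwinnertonDyer.BirchSwinnertonDyer.Theorems.ManinLocalTwoThree.ThreeShiftDescent (g0Of_mul det_mul_entries)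

namespace Summit.BirchSwinnertonDyer.BirchSwinnertonDyer.Theorems.ManinLocalTwoThree

namespace PrimeShift

/-! ### §0. Generic plumbing in the `ShiftEqualiser` vocabulary -/

section Plumbing

variable {K : Type*} [CommRing K] {M N : ℕ}

/-- An additive map kills `1`. [folklore] -/
theorem isAdd_map_one {φ : Gamma0 N → K} (h : IsAdd φ) : φ 1 = 0 := by
  have := h 1 1
  rw [one_mul] at this
  have e : φ 1 + φ 1 - φ 1 = φ 1 - φ 1 := by rw [← this]
  simpa using e

/-- An additive map on natural powers: `φ(γ^k) = k·φ(γ)`. [folklore] -/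
theorem isAdd_map_pow {φ : Gamma0 N → K} (h : IsAdd φ) (γ : Gamma0 N) (k : ℕ) : φ (γ ^ k) = (k : K) * φ γ := by
  induction k with
  | zero => rw [pow_zero, isAdd_map_one h, Nat.cast_zero, zero_mul]
  | succ k ih => rw [pow_succ, h, ih, Nat.cast_succ]; ring

omit [CommRing K] in
/-- **Restriction of a diamond class is a diamond class** (`Γ₁(N) ≤ Γ₁(M)` for `M ∣ N`), generic vocabulary. [folklore] -/
theorem isDiamond_of_restrictsFrom [Zero K] (hMN : M ∣ N) {φ : Gamma0 N → K} {w : Gamma0 M → K}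
    (hres : RestrictsFrom φ w) (hw : IsDiamond w) : IsDiamond φ := by
  intro γ hγ
  obtain ⟨h00, h11, h10⟩ := (Gamma1_mem N γ).mp hγ
  have hγM : γ ∈ Gamma1 M := by
    rw [Gamma1_mem]
    refine ⟨?_, ?_, ?_⟩
    · have := intCast_zmod_eq_of_dvd hMN (x := (γ 0 0 : ℤ)) (y := 1) (by push_cast; exact h00)
      push_cast at this; exact this
    · have := intCast_zmod_eq_of_dvd hMN (x := (γ 1 1 : ℤ)) (y := 1) (by push_cast; exact h11)
      push_cast at this; exact this
    · have := intCast_zmod_eq_of_dvd hMN (x := (γ 1 0 : ℤ)) (y := 0) (by push_cast; exact h10)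
      push_cast at this; exact this
  set γN : Gamma0 N := ⟨γ, Gamma1_in_Gamma0 N hγ⟩ with hγN
  have hcN : (N : ℤ) ∣ (γN : SL(2, ℤ)) 1 0 := (ZMod.intCast_zmod_eq_zero_iff_dvd _ N).mp (Gamma0_mem.mp γN.2)
  have hcM : (M : ℤ) ∣ (γN : SL(2, ℤ)) 1 0 := (Int.natCast_dvd_natCast.mpr hMN).trans hcN
  have key := hres ((γN : SL(2, ℤ)) 0 0) ((γN : SL(2, ℤ)) 0 1) ((γN : SL(2, ℤ)) 1 0) ((γN : SL(2, ℤ)) 1 1)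
    (gamma0_det_entries γN) hcN hcM
  rw [g0Of_entries γN] at key
  rw [key]
  have e : (g0Of ((γN : SL(2, ℤ)) 0 0) ((γN : SL(2, ℤ)) 0 1) ((γN : SL(2, ℤ)) 1 0) ((γN : SL(2, ℤ)) 1 1)
      (gamma0_det_entries γN) hcM : Gamma0 M) = ⟨γ, Gamma1_in_Gamma0 M hγM⟩ := by
    apply Subtype.ext
    rw [← coe_g0Of_eq _ _ _ _ (gamma0_det_entries γN) hcN hcM, g0Of_entries γN]
  rw [e]
  exact hw γ hγM

/-- Powers of a unipotent explicit matrix: `(1+e, f; g, 1−e)^k = (1+ke, kf; kg, 1−ke)` when `e² + fg = 0`. [folklore] -/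
theorem unipotent_pow {L : ℕ} (e f g : ℤ) (hefg : e * e + f * g = 0) (hg : (L : ℤ) ∣ g) (k : ℕ) :
    (g0Of (1 + e) f g (1 - e) (by linear_combination (-1 : ℤ) * hefg) hg : Gamma0 L) ^ k =
      g0Of (1 + k * e) (k * f) (k * g) (1 - k * e) (by linear_combination (-((k : ℤ) * k)) * hefg)
        (Dvd.dvd.mul_left hg k) := by
  induction k with
  | zero =>
      rw [pow_zero]
      apply Subtype.ext
      ext i j
      fin_cases i <;> fin_cases j <;> simp [g0Of, slOf]
  | succ k ih =>
      rw [pow_succ, ih, g0Of_mul _ _ _ _ _ _ _ _ _ _ _ _ (det_mul_entries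
        (by linear_combination (-((k : ℤ) * k)) * hefg) (by linear_combination (-1 : ℤ) * hefg))
        (dvd_add (Dvd.dvd.mul_right (Dvd.dvd.mul_left hg k) _) (Dvd.dvd.mul_left hg _))]
      exact g0Of_congr (by push_cast; linear_combination (k : ℤ) * hefg) (by push_cast; ring) (by push_cast; ring)
        (by push_cast; linear_combination (k : ℤ) * hefg) _ _ _ _

end Plumbing

/-! ### §1. `p² ∣ n`: both parabolics are `p`-th powers after one shift — the AUTOMATIC step -/

section Automatic

variable {K : Type*} [CommRing K] {p : ℕ}

/-- `φ(P_{1/p}) = 0` at level `p²n` with `n = p²m`, for additive `p`-shift-invariant `φ` and `(p : K) = 0`: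
`P_{1/p} = (1−p³m, p·(pm); −p⁴m, 1+p³m)` shifts to `(1−p³m, pm; −p⁵m, 1+p³m) = u^p`, `u = (1−p²m, m; −p⁴m, 1+p²m)`. [folklore] -/
theorem apply_P1_eq_zero_of_sq_dvd (hpK : (p : K) = 0) (m : ℕ) (φ : Gamma0 (p * (p * (p * (p * m)))) → K)
    (hadd : IsAdd φ) (hinv : IsShiftInvariant (p : ℤ) φ) : φ (P1 p (p * (p * m))) = 0 := by
  have hlev : ((p * (p * (p * (p * m))) : ℕ) : ℤ) ∣ -(p * (p * (p * (p * m)))) := ⟨-1, by push_cast; ring⟩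
  have e1 : P1 p (p * (p * m)) = g0Of (1 - p * (p * (p * m))) ((p : ℤ) * (p * m)) (-(p * (p * (p * (p * m)))))
      (1 + p * (p * (p * m))) (by ring) hlev := g0Of_congr (by push_cast; ring) (by push_cast; ring) (by push_cast; ring)
        (by push_cast; ring) _ _ _ _
  have h2 := hinv (1 - p * (p * (p * m))) (p * m) (-(p * (p * (p * (p * m))))) (1 + p * (p * (p * m))) (by ring) hlev
  have hefg : (-((p : ℤ) * (p * m))) * (-((p : ℤ) * (p * m))) + (m : ℤ) * (-(p * (p * (p * (p * m))))) = 0 := by ring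
  have hg : ((p * (p * (p * (p * m))) : ℕ) : ℤ) ∣ -((p : ℤ) * (p * (p * (p * m)))) := ⟨-1, by push_cast; ring⟩
  have e3 : (g0Of (M := p * (p * (p * (p * m)))) (1 - p * (p * (p * m))) (p * m) ((p : ℤ) * -(p * (p * (p * (p * m)))))
        (1 + p * (p * (p * m))) (by ring) (Dvd.dvd.mul_left hlev (p : ℤ))) =
      (g0Of (1 + -((p : ℤ) * (p * m))) m (-((p : ℤ) * (p * (p * (p * m))))) (1 - -((p : ℤ) * (p * m)))
        (by linear_combination (-1 : ℤ) * hefg) hg) ^ p := by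
    rw [unipotent_pow _ _ _ hefg hg p]
    exact g0Of_congr (by ring) (by ring) (by ring) (by ring) _ _ _ _
  rw [e1, h2, e3, isAdd_map_pow hadd, hpK, zero_mul]

/-- `φ(P_{2/p}) = 0` likewise: `P_{2/p}` shifts to `(1−2p³m, 4pm; −p⁵m, 1+2p³m) = u₂^p`, `u₂ = (1−2p²m, 4m; −p⁴m, 1+2p²m)`. [folklore] -/
theorem apply_P2_eq_zero_of_sq_dvd (hpK : (p : K) = 0) (m : ℕ) (φ : Gamma0 (p * (p * (p * (p * m)))) → K)
    (hadd : IsAdd φ) (hinv : IsShiftInvariant (p : ℤ) φ) : φ (P2 p (p * (p * m))) = 0 := by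
  have hlev : ((p * (p * (p * (p * m))) : ℕ) : ℤ) ∣ -(p * (p * (p * (p * m)))) := ⟨-1, by push_cast; ring⟩
  have e1 : P2 p (p * (p * m)) = g0Of (1 - 2 * (p * (p * (p * m)))) ((p : ℤ) * (4 * (p * m))) (-(p * (p * (p * (p * m)))))
      (1 + 2 * (p * (p * (p * m)))) (by ring) hlev := g0Of_congr (by push_cast; ring) (by push_cast; ring)
        (by push_cast; ring) (by push_cast; ring) _ _ _ _
  have h2 := hinv (1 - 2 * (p * (p * (p * m)))) (4 * (p * m)) (-(p * (p * (p * (p * m))))) (1 + 2 * (p * (p * (p * m))))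
    (by ring) hlev
  have hefg : (-(2 * ((p : ℤ) * (p * m)))) * (-(2 * ((p : ℤ) * (p * m)))) + (4 * (m : ℤ)) * (-(p * (p * (p * (p * m))))) = 0 := by
    ring
  have hg : ((p * (p * (p * (p * m))) : ℕ) : ℤ) ∣ -((p : ℤ) * (p * (p * (p * m)))) := ⟨-1, by push_cast; ring⟩
  have e3 : (g0Of (M := p * (p * (p * (p * m)))) (1 - 2 * (p * (p * (p * m)))) (4 * (p * m))
        ((p : ℤ) * -(p * (p * (p * (p * m))))) (1 + 2 * (p * (p * (p * m)))) (by ring) (Dvd.dvd.mul_left hlev (p : ℤ))) =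
      (g0Of (1 + -(2 * ((p : ℤ) * (p * m)))) (4 * m) (-((p : ℤ) * (p * (p * (p * m))))) (1 - -(2 * ((p : ℤ) * (p * m))))
        (by linear_combination (-1 : ℤ) * hefg) hg) ^ p := by
    rw [unipotent_pow _ _ _ hefg hg p]
    exact g0Of_congr (by ring) (by ring) (by ring) (by ring) _ _ _ _
  rw [e1, h2, e3, isAdd_map_pow hadd, hpK, zero_mul]

/-- **AUTOMATIC DESCENT for `p² ∣ n`** (`(p : K) = 0`): every additive `p`-shift-invariant `φ : Γ₀(p²n) → K`, `n = p²m`,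
is a restriction from `Γ₀(pn)`. [folklore] -/
theorem descent_of_sq_dvd [NeZero p] (hpK : (p : K) = 0) (m : ℕ) (φ : Gamma0 (p * (p * (p * (p * m)))) → K)
    (hadd : IsAdd φ) (hinv : IsShiftInvariant (p : ℤ) φ) :
    ∃ w : Gamma0 (p * (p * (p * m))) → K, IsAdd w ∧ IsShiftInvariant (p : ℤ) w ∧ RestrictsFrom φ w :=
  descent φ hadd hinv (by rw [apply_P1_eq_zero_of_sq_dvd hpK m φ hadd hinv, apply_P2_eq_zero_of_sq_dvd hpK m φ hadd hinv])

variable (K) in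
/-- **THE AUTOMATIC STEP**: `K_p(p³m) = D ⟹ K_p(p⁴m) = D` over any `K` with `(p : K) = 0` (so all steps above depth `p³`
of the `p`-power tower are free). [folklore] -/
theorem step_of_sq_dvd [NeZero p] (hpK : (p : K) = 0) (m : ℕ) (h : ShiftInvariantIsDiamondAt K p (p * (p * (p * m)))) :
    ShiftInvariantIsDiamondAt K p (p * (p * (p * (p * m)))) := by
  intro φ hadd hinv
  obtain ⟨w, hw, hws, hres⟩ := descent_of_sq_dvd hpK m φ hadd hinv
  exact isDiamond_of_restrictsFrom ⟨p, by ring⟩ hres (h w hw hws)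

end Automatic

/-! ### §2. `n = N₀` prime to `p`: the Fermat-quotient character ABSORBS the obstruction -/

section Absorb

variable {K : Type*} [Field K] {p : ℕ} [hp : Fact p.Prime] [CharP K p]

/-- `ψ(P_{1/p}) = −n` (`d(P_{1/p}) = 1 + pn`). [folklore] -/
theorem fqChar_P1 (n : ℕ) : fqChar K p (P1 p n) = -(n : K) := by
  rw [fqChar_eq_of_d_eq (P1 p n) (n : ℤ) rfl, Int.cast_natCast]

/-- `ψ(P_{2/p}) = −2n` (`d(P_{2/p}) = 1 + 2pn`). [folklore] -/
theorem fqChar_P2 (n : ℕ) : fqChar K p (P2 p n) = -(2 * (n : K)) := by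
  rw [fqChar_eq_of_d_eq (P2 p n) (2 * n : ℤ) (by show (1 : ℤ) + 2 * (p * n) = 1 + p * (2 * n); ring)]
  push_cast
  ring

variable (K) in
/-- **THE ABSORBER STEP**: `K_p(pN₀) = D ⟹ K_p(p²N₀) = D` for `p ∤ N₀`, over a field of characteristic `p`.  For
`φ ∈ K_p(p²N₀)` put `κ = φ(P_{2/p}) − φ(P_{1/p})`; the Fermat-quotient character `ψ` is additive, diamond, shift invariant,
with `ψ(P_{2/p}) − ψ(P_{1/p}) = −N₀ ≠ 0`, so `φ' = φ + κ N₀⁻¹ ψ` passes the test of `PrimeShift.descent`, restricts from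
`K_p(pN₀) = D`, hence is diamond, and so is `φ = φ' − κ N₀⁻¹ ψ`. [folklore] -/
theorem step_absorb (N₀ : ℕ) (hN₀ : ¬ p ∣ N₀) (h : ShiftInvariantIsDiamondAt K p (p * N₀)) :
    ShiftInvariantIsDiamondAt K p (p * (p * N₀)) := by
  haveI : NeZero p := ⟨hp.out.ne_zero⟩
  intro φ hadd hinv
  have hL : p ^ 2 ∣ p * (p * N₀) := ⟨N₀, by ring⟩
  have hψadd := isAdd_fqChar (K := K) (p := p) hL
  have hψD := isDiamond_fqChar (K := K) (p := p) hL
  have hψinv := isShiftInvariant_fqChar (K := K) (p := p) (L := p * (p * N₀)) (p : ℤ)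
  have hN : (N₀ : K) ≠ 0 := fun h0 => hN₀ ((CharP.cast_eq_zero_iff K p N₀).mp h0)
  have hNinv : (N₀ : K)⁻¹ * (N₀ : K) = 1 := inv_mul_cancel₀ hN
  set φ' : Gamma0 (p * (p * N₀)) → K :=
    fun γ => φ γ + (φ (P2 p N₀) - φ (P1 p N₀)) * (N₀ : K)⁻¹ * fqChar K p γ with hφ'
  have hadd' : IsAdd φ' := by
    intro γ δ
    simp only [hφ']
    rw [hadd, hψadd]
    ring
  have hinv' : IsShiftInvariant (p : ℤ) φ' := by
    intro a b c d hdet hc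
    simp only [hφ']
    rw [hinv a b c d hdet hc, hψinv a b c d hdet hc]
  have hP : φ' (P2 p N₀) = φ' (P1 p N₀) := by
    simp only [hφ']
    rw [fqChar_P1, fqChar_P2]
    linear_combination (-(φ (P2 p N₀) - φ (P1 p N₀))) * hNinv
  obtain ⟨w, hw, hws, hres⟩ := descent φ' hadd' hinv' hP
  have hD' : IsDiamond φ' := isDiamond_of_restrictsFrom ⟨p, by ring⟩ hres (h w hw hws)
  intro γ hγ
  have e : φ ⟨γ, Gamma1_in_Gamma0 _ hγ⟩ = φ' ⟨γ, Gamma1_in_Gamma0 _ hγ⟩ -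
      (φ (P2 p N₀) - φ (P1 p N₀)) * (N₀ : K)⁻¹ * fqChar K p ⟨γ, Gamma1_in_Gamma0 _ hγ⟩ := by
    simp only [hφ']
    ring
  rw [e, hD' γ hγ, hψD γ hγ]
  ring

end Absorb

/-! ### §3. The tower and the reduction of the LEAD's law to two single-depth laws per prime -/

section Tower

variable {K : Type*} [Field K] {p : ℕ} [hp : Fact p.Prime] [CharP K p]

variable (K) in
/-- all depths `≥ p³`: from `Base₁` and `Step₃` by the absorber (depth `p²`), `Step₃` (depth `p³`) and the automatic
steps (every higher depth). [folklore] -/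
theorem tower_nested (N₀ : ℕ) (hN₀ : ¬ p ∣ N₀) (base : ShiftInvariantIsDiamondAt K p (p * N₀))
    (step3 : ShiftInvariantIsDiamondAt K p (p * (p * N₀)) → ShiftInvariantIsDiamondAt K p (p * (p * (p * N₀)))) :
    ∀ j : ℕ, ShiftInvariantIsDiamondAt K p (p * (p * (p * (p ^ j * N₀)))) := by
  haveI : NeZero p := ⟨hp.out.ne_zero⟩
  have hpK : (p : K) = 0 := CharP.cast_eq_zero K p
  intro j
  induction j with
  | zero =>
      rw [show p * (p * (p * (p ^ 0 * N₀))) = p * (p * (p * N₀)) by ring]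
      exact step3 (step_absorb K N₀ hN₀ base)
  | succ j ih =>
      rw [show p * (p * (p * (p ^ (j + 1) * N₀))) = p * (p * (p * (p * (p ^ j * N₀)))) by ring]
      exact step_of_sq_dvd K hpK (p ^ j * N₀) ih

variable (K) in
/-- **THE `p`-POWER TOWER**: `K_p(p^{k+1} N₀) = D` over `K` (characteristic `p`) for EVERY `k`, from the two single-depth
inputs `Base₁ : K_p(pN₀) = D` and `Step₃ : K_p(p²N₀) = D → K_p(p³N₀) = D` (`p ∤ N₀`). [folklore] -/
theorem shiftInvariantIsDiamondAt_tower (N₀ : ℕ) (hN₀ : ¬ p ∣ N₀) (base : ShiftInvariantIsDiamondAt K p (p * N₀))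
    (step3 : ShiftInvariantIsDiamondAt K p (p * (p * N₀)) → ShiftInvariantIsDiamondAt K p (p * (p * (p * N₀)))) :
    ∀ k : ℕ, ShiftInvariantIsDiamondAt K p (p ^ (k + 1) * N₀)
  | 0 => by
      rw [show p ^ (0 + 1) * N₀ = p * N₀ by ring]
      exact base
  | 1 => by
      rw [show p ^ (1 + 1) * N₀ = p * (p * N₀) by ring]
      exact step_absorb K N₀ hN₀ base
  | (j + 2) => by
      rw [show p ^ (j + 2 + 1) * N₀ = p * (p * (p * (p ^ j * N₀))) by ring]
      exact tower_nested K N₀ hN₀ base step3 j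

end Tower

section ByName

variable {p : ℕ}

/-- **THE LAW AT ONE PRIME from two single-depth laws**: `PrimeShiftInvariantIsDiamondAtPrime p` (every level `N`) follows
from `Base₁(p) : ∀ N₀, p ∤ N₀ → K_p(pN₀) = D` and `Step₃(p) : ∀ N₀, p ∤ N₀ → (K_p(p²N₀) = D → K_p(p³N₀) = D)` over `ℤ/p`
(`p ∤ N` is p2's theorem, `N = 0` the typer's, both inside `primeShiftInvariantIsDiamondAtPrime_of_dvd`). [folklore] -/
theorem primeShiftInvariantIsDiamondAtPrime_of_bases (hp' : p.Prime)
    (base : ∀ N₀ : ℕ, ¬ p ∣ N₀ → ShiftInvariantIsDiamondAt (ZMod p) p (p * N₀))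
    (step3 : ∀ N₀ : ℕ, ¬ p ∣ N₀ → ShiftInvariantIsDiamondAt (ZMod p) p (p * (p * N₀)) →
      ShiftInvariantIsDiamondAt (ZMod p) p (p * (p * (p * N₀)))) :
    PrimeShiftInvariantIsDiamondAtPrime p := by
  haveI : Fact p.Prime := ⟨hp'⟩
  refine primeShiftInvariantIsDiamondAtPrime_of_dvd hp' (fun N hN hpN => ?_)
  obtain ⟨e, N₀, hN₀, rfl⟩ := Nat.exists_eq_pow_mul_and_not_dvd hN.ne' p hp'.ne_one
  obtain ⟨k, rfl⟩ : ∃ k, e = k + 1 :=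
    Nat.exists_eq_succ_of_ne_zero (by rintro rfl; rw [pow_zero, one_mul] at hpN; exact hN₀ hpN)
  exact shiftInvariantIsDiamondAt_tower (ZMod p) N₀ hN₀ (base N₀ hN₀) (step3 N₀ hN₀) k


/-- **THE LEAD's LAW REDUCED TO TWO SINGLE-DEPTH LAWS PER PRIME `p ≥ 5`**: `PrimeShiftInvariantIsDiamond` holds as soon as,
for every prime `p ≥ 5` and every `N₀` prime to `p`, (Base₁) `K_p(pN₀) = D(pN₀)` — the index-`(p+1)` step over p2's Serre base —
and (Step₃) `K_p(p²N₀) = D → K_p(p³N₀) = D` — the one depth where no congruence character certifies the descent (es §37.13 (C);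
Heisenberg input: p2's `exists_heisenbergLift_of_five_le`).  Its `p = 2, 3` instances and `p ∤ N` are tree theorems
(`ShiftEqualiser.primeShiftInvariantIsDiamond_iff_five_le_dvd`).  A REDUCTION: the law itself stays OPEN. [folklore] -/
theorem primeShiftInvariantIsDiamond_of_bases
    (h : ∀ p : ℕ, p.Prime → 5 ≤ p →
      (∀ N₀ : ℕ, ¬ p ∣ N₀ → ShiftInvariantIsDiamondAt (ZMod p) p (p * N₀)) ∧
      (∀ N₀ : ℕ, ¬ p ∣ N₀ → ShiftInvariantIsDiamondAt (ZMod p) p (p * (p * N₀)) →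
        ShiftInvariantIsDiamondAt (ZMod p) p (p * (p * (p * N₀))))) :
    PrimeShiftInvariantIsDiamond :=
  primeShiftInvariantIsDiamond_iff_five_le_dvd.mpr fun p hp h5 N _ _ =>
    primeShiftInvariantIsDiamondAtPrime_of_bases hp (h p hp h5).1 (h p hp h5).2 N

end ByName

end PrimeShift

end Summit.BirchSwinnertonDyer.BirchSwinnertonDyer.Theorems.ManinLocalTwoThree
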